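import Summits.QuantumFields.BalabanUV.Beta.FP.PackedVertexPeriodisation
import Summits.QuantumFields.BalabanUV.Beta.CombHId2FoldsSlots

/-!
# `BalabanUV.Beta.FP.PackedRecordSlots` — road «FP» for binder row D1, ROUTE T, memo `N2B-DESIGN.md` (34h) STEP 3, letter (S3-2)-(ii) AT THE RECORD, ORDER 2:
# **THE RECORD's TWO SECOND-ORDER SLOTS — the bi-vertex over `S₂^{per,csf}` (where `H₂` binds) and the mixed bi-vertex over `M₂^{per,cs}` (where `Q₁₂`
# binds) — ARE `perF ∘ dper` OF ONE PACKED BI-LOCALISED KERNEL EACH, with the averaging kernel's `Â`-columns as packing weights**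

WHY.  an2's PART THREE letters 2c-i `CombHId2FoldsSlots` (p357294 ✓) read the record-shape second-order slots entrywise as DOUBLE SUMS over bonds of
`Â · (Â · perF M (dper M slot))` (`perF_vertex2OfK_csf_per`, `perF_mixOfK_cs_per`).  The level-0 socket (#36b) and its adapters (#37, #37c) carry the
door's second form jet as `H₂ v v′ = a² • Σ_b Σ_b′ (hv v b · hv v′ b′) • TWW b b′` — a PACKED table family; STEP 3 must recognise the packed slot as
`perF M (dper M 𝒲)` of ONE kernel so that (P2‴)'s `hlaw` can be stated.  #38 `PackedVertexPeriodisation` (§2 `sum_sum_smul_perF_dper`) is the abstract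
packing letter; THIS FILE applies it AT THE RECORD, by term, to an2's two slot lemmas: the weights ARE the `Â := perF M K` columns of the two top bonds
(fine × fine for the field slot, fine × coarse for the mixed slot), the bi-localisation witnesses are PART TWO-c's `biLoc_S₂_csf` ∕ `biLoc_M₂_cs`.
[folklore] composition BY NAME; no `def`, no `def … : Prop`, nothing cited, 0 sorry.  NOT HERE: the identification of the socket's direction read-out
`hv (d k)` with the `Â`-column (the nested layer's `V := σ → ℝ` instance), the first-order slots (an2 2c-iii `perF_vertexOfK_comb_apply` ∕
`perF_vertexOfM_comb_apply` once landed), the legs (S3-1), the assembly (S3-3).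

HONEST DEPENDENCY (page 1, mandatory): continuum YM on T⁴ ⇐ BetaPertH ∧ nine spine estimates (0/9 proved); BetaPertH ⇐ (D1) ∧ (D4) ∧ CAP+tail;
G-an2-4 gates asym, D1 and NE2/3/4.  HONEST FRAMING (cell contract, verbatim): «discharging `BetaPertH` makes Bałaban's UV stability UNCONDITIONAL —
a real constructive-QFT result; it is NOT the continuum limit and NOT the Clay problem.»  ABSOLUTE RULE (cell charter, verbatim): «No internally-minted
statement may enter as a cited fact. Every hypothesis is either kernel-proved in this package or a verbatim quotation of a PUBLISHED theorem with page
reference. The manuscript(s) under audit are NOT citable for their own disputed steps — they are the thing under adjudication; programme-internal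
(2001/route/tribunal) claims are never citable.»  Finite sums of absolutely convergent period sums over OUR typed objects; nothing of the dictionary's
identification ∕ Bałaban's asserted; 0 estimates beyond the cited decay constants; 0∕4 row-D1 binders (hW, hR, D1Tel, D1Rep); NOT (T-ID), NOT SDF, NOT
D1, NOT BetaPertH, NOT continuum, NOT Clay.  Road «FP» OWNER, b2b-balaban-beta-d1-p3 gen 25, 2026-08-23.  No existing file touched.
-/

noncomputable section

open scoped BigOperators Matrix

namespace Summit.QuantumFields.BalabanUV.Beta.FP.PackedRecordSlots

open Literature.MathematicalPhysics.QuantumFieldTheory.Balaban1983to89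
open Literature.MathematicalPhysics.QuantumFieldTheory.Balaban1983to89.Beta
open B4TorusKernel.MultiPeriod (translate)
open ExpKernelCalculus (MKer Decays BiLoc shiftK)
open AffineAveraging (Site)
open OneStepResolventKernel (Fib)
open BalabanCompositeJets (LocStencil₂)
open SecondOrderResponse (vertex2OfK)
open Summit.QuantumFields.BalabanUV.Beta.FP.KernelPeriodisationFib (Idx perF)
open Summit.QuantumFields.BalabanUV.Beta.FP.KernelPeriodisationFibLoc (dper)
open Summit.QuantumFields.BalabanUV.Beta.FP.TorusGaugeCovariancePairing (wrapPt)
open B6Lemma24Torus (pbox)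
open Summit.QuantumFields.BalabanUV.Beta.CombHId2W2Vertex2 (biLoc_S₂_csf)
open Summit.QuantumFields.BalabanUV.Beta.CombHId2W2Words (biLoc_M₂_cs)
open Summit.QuantumFields.BalabanUV.Beta.CombHId2FoldsSlots (perF_vertex2OfK_csf_per perF_mixOfK_cs_per)
open Summit.QuantumFields.BalabanUV.Beta.FP.PackedVertexPeriodisation (sum_sum_smul_perF_dper)

variable {d : ℕ} (M : Fin (d + 1) → ℕ) [∀ μ, NeZero (M μ)] {N : ℕ} {M' : Fin (d + 1) → ℕ} {K : MKer (d + 1) (Fib d)} {CK δK : ℝ}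
  {S₂ M₂ : Fin (d + 1) → Site (d + 1) → Fin (d + 1) → Site (d + 1) → MKer (d + 1) (Fib d)} {C₂ δ₂ Cm δm : ℝ}

/-! ## §1 The FIELD slot: the record's bi-vertex over `S₂^{per,csf}` packs -/

/-- [folklore] **`perF_vertex2OfK_csf_per_packed` — THE RECORD's BI-VERTEX IS `perF∘dper` OF ONE PACKED KERNEL**: under exactly the hypotheses of an2's
`CombHId2FoldsSlots.perF_vertex2OfK_csf_per` (THE SHAPE `H₂` BINDS), `perF M (vertex2OfK K N S₂^{per,csf} μ y ν y′) = perF M (dper M (Σ_b Σ_b′ (Â_b(μ,y) ·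
Â_b′(ν,y′)) • S₂^{csf-kernel} b b′))`, the weights being the `Â := perF M K`-COLUMNS of the two top bonds over the fine bonds `b = (u, κ)` — the socket's
`hH₂` shape `Σ_b Σ_b′ (hv v b · hv v′ b′) • TWW b b′` at `hv (d k) := Â(·, k)` (#38 §2 `sum_sum_smul_perF_dper`, BiLoc by `CombHId2W2Vertex2.biLoc_S₂_csf`). -/
theorem perF_vertex2OfK_csf_per_packed (hM : ∀ i, M i = N * M' i)
    (hKinv : ∀ (m x z : Site (d + 1)) (a b : Fib d), K (translate M x m) (translate M z m) a b = K x z a b)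
    (hK : Decays K CK δK) (hδK : 0 < δK)
    (hS₂s : ∀ (κ : Fin (d + 1)) (u : Site (d + 1)) (κ' : Fin (d + 1)) (u' t : Site (d + 1)),
      S₂ κ (u + (N : ℤ) • t) κ' (u' + (N : ℤ) • t) = shiftK (-((N : ℤ) • t)) (S₂ κ u κ' u'))
    (hS₂ : LocStencil₂ S₂ C₂ δ₂) (hδ₂ : 0 < δ₂)
    (μ : Fin (d + 1)) (y : Site (d + 1)) (ν : Fin (d + 1)) (y' : Site (d + 1)) :
    perF M (vertex2OfK K N (fun κ u κ' u' => dper M (fun x z a c => ∑' n : Site (d + 1), S₂ κ u κ' (translate M u' n) x z a c)) μ y ν y')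
      = perF M (dper M (∑ b : ↥(pbox M) × Fin (d + 1), ∑ b' : ↥(pbox M) × Fin (d + 1),
          (perF M K (b.1, Sum.inl b.2) (wrapPt M ((N : ℤ) • y), Sum.inr μ) * perF M K (b'.1, Sum.inl b'.2) (wrapPt M ((N : ℤ) • y'), Sum.inr ν))
            • (fun x z a c => ∑' n : Site (d + 1), S₂ b.2 (b.1 : Site (d + 1)) b'.2 (translate M (b'.1 : Site (d + 1)) n) x z a c))) := by
  have h := sum_sum_smul_perF_dper M (Finset.univ : Finset (↥(pbox M) × Fin (d + 1))) (Finset.univ : Finset (↥(pbox M) × Fin (d + 1)))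
      (fun b : ↥(pbox M) × Fin (d + 1) => perF M K (b.1, Sum.inl b.2) (wrapPt M ((N : ℤ) • y), Sum.inr μ))
      (fun b' : ↥(pbox M) × Fin (d + 1) => perF M K (b'.1, Sum.inl b'.2) (wrapPt M ((N : ℤ) • y'), Sum.inr ν))
      (fun b b' => fun x z a c => ∑' n : Site (d + 1), S₂ b.2 (b.1 : Site (d + 1)) b'.2 (translate M (b'.1 : Site (d + 1)) n) x z a c)
      (fun b _ b' _ => ⟨_, _, _, _, (biLoc_S₂_csf M hS₂ hδ₂ b.2 (b.1 : Site (d + 1)) b'.2 (b'.1 : Site (d + 1))).nonneg (Sum.inl 0), hδ₂,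
        biLoc_S₂_csf M hS₂ hδ₂ b.2 (b.1 : Site (d + 1)) b'.2 (b'.1 : Site (d + 1))⟩)
  rw [← h]
  ext P Q
  rw [perF_vertex2OfK_csf_per M hM hKinv hK hδK hS₂s hS₂ hδ₂ μ y ν y' P Q]
  simp only [Matrix.sum_apply, Matrix.smul_apply, smul_eq_mul, Fintype.sum_prod_type, mul_assoc]

/-! ## §2 The MIXED slot: the record's mixed bi-vertex over `M₂^{per,cs}` packs (two different index types) -/

/-- [folklore] **`perF_mixOfK_cs_per_packed`** — under exactly the hypotheses of an2's `CombHId2FoldsSlots.perF_mixOfK_cs_per` (THE SHAPE `Q₁₂` BINDS),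
`perF M (mixOfK K N M₂^{per,cs} μ y ν y′) = perF M (dper M (Σ_{b : fine} Σ_{b′ : coarse} (Â_b(μ,y) · Â((wrapPt M (N•b′.1), inr b′.2),(ν,y′))) • M₂^{cs-kernel} b b′))` —
ONE packed kernel over the fine × COARSE bond index pair (#38 §2 with `ι ≠ ι′`; BiLoc by `CombHId2W2Words.biLoc_M₂_cs`). -/
theorem perF_mixOfK_cs_per_packed [NeZero N] [∀ μ, NeZero (M' μ)] (hM : ∀ i, M i = N * M' i)
    (hKinv : ∀ (m x z : Site (d + 1)) (a b : Fib d), K (translate M x m) (translate M z m) a b = K x z a b)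
    (hK : Decays K CK δK) (hδK : 0 < δK)
    (hM₂t : ∀ (κ : Fin (d + 1)) (u : Site (d + 1)) (ρ : Fin (d + 1)) (w m x z : Site (d + 1)) (a c : Fib d),
      M₂ κ (translate M u m) ρ (translate M' w m) (translate M x m) (translate M z m) a c = M₂ κ u ρ w x z a c)
    (hM₂ : SecondOrderResponse.LocStencilFM N M₂ Cm δm) (hδm : 0 < δm)
    (μ : Fin (d + 1)) (y : Site (d + 1)) (ν : Fin (d + 1)) (y' : Site (d + 1)) :
    perF M (SecondOrderResponse.mixOfK K N (fun κ u ρ w => dper M (fun x z a c => ∑' n : Site (d + 1), M₂ κ u ρ (translate M' w n) x z a c)) μ y ν y')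
      = perF M (dper M (∑ b : ↥(pbox M) × Fin (d + 1), ∑ b' : ↥(pbox M') × Fin (d + 1),
          (perF M K (b.1, Sum.inl b.2) (wrapPt M ((N : ℤ) • y), Sum.inr μ)
              * perF M K (wrapPt M ((N : ℤ) • (b'.1 : Site (d + 1))), Sum.inr b'.2) (wrapPt M ((N : ℤ) • y'), Sum.inr ν))
            • (fun x z a c => ∑' n : Site (d + 1), M₂ b.2 (b.1 : Site (d + 1)) b'.2 (translate M' (b'.1 : Site (d + 1)) n) x z a c))) := by
  have h := sum_sum_smul_perF_dper M (Finset.univ : Finset (↥(pbox M) × Fin (d + 1))) (Finset.univ : Finset (↥(pbox M') × Fin (d + 1)))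
      (fun b : ↥(pbox M) × Fin (d + 1) => perF M K (b.1, Sum.inl b.2) (wrapPt M ((N : ℤ) • y), Sum.inr μ))
      (fun b' : ↥(pbox M') × Fin (d + 1) => perF M K (wrapPt M ((N : ℤ) • (b'.1 : Site (d + 1))), Sum.inr b'.2) (wrapPt M ((N : ℤ) • y'), Sum.inr ν))
      (fun b b' => fun x z a c => ∑' n : Site (d + 1), M₂ b.2 (b.1 : Site (d + 1)) b'.2 (translate M' (b'.1 : Site (d + 1)) n) x z a c)
      (fun b _ b' _ => ⟨_, _, _, _, (biLoc_M₂_cs M hM hM₂ hδm b.2 (b.1 : Site (d + 1)) b'.2 (b'.1 : Site (d + 1))).nonneg (Sum.inl 0), hδm,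
        biLoc_M₂_cs M hM hM₂ hδm b.2 (b.1 : Site (d + 1)) b'.2 (b'.1 : Site (d + 1))⟩)
  rw [← h]
  ext P Q
  rw [perF_mixOfK_cs_per M hM hKinv hK hδK hM₂t hM₂ hδm μ y ν y' P Q]
  simp only [Matrix.sum_apply, Matrix.smul_apply, smul_eq_mul, Fintype.sum_prod_type, mul_assoc]

end Summit.QuantumFields.BalabanUV.Beta.FP.PackedRecordSlots

end
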